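import Mathlib
import Summits.NavierStokesRegularity.NavierStokesRegularity.Theorems.EulerZoomLiouvillePowerGaugeEulerLiouvilleHoopCylinder
import Summits.NavierStokesRegularity.NavierStokesRegularity.Theorems.EulerZoomLiouvillePowerGaugeEulerLiouvilleHoopDensityBound
import HarnessLib

/-!
# HOOP LINE, H-CYL part 2 — the two sides of the hoop inequality in cylinder coordinates
# (route `EulerZoomLiouville`, crux E = stmt-NavierStokesRegularity-19832; class-free, `--supports` only)

Continuation of `…HoopCylinder` (the change of variables on `HoopCore.solidCyl`) for the two volume integrals of
`HoopCore.HoopInequality`: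

* `measurable_hoopDensity` — the atom-subtracted hoop density of a continuous field is measurable;
* `integrableOn_hoopDensity_solidCyl` — **it is integrable on every solid cylinder** for `V ∈ C¹`, `T₀ > 0`
  (`integrableOn_solidCyl_iff` of `…HoopCylinder` + ezl-w3 g6's bound `exists_mul_abs_hoopDensity_le_solidCyl` of
  `…HoopDensityBound`: `t · |hoopDensity V (axisPt σ t θ)| ≤ C` on the coordinate box, which has finite measure);
* `setIntegral_hoopDensity_solidCyl_eq` — `∫_Z hoopDensity V = ∫_{s₁}^{s₂} ∫₀^{T₀} t · ∫₀^{2π} hoopDensity V (axisPt σ t θ)`;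
* `integrableOn_frobeniusNormSq_fderiv_solidCyl`, `setIntegral_frobeniusNormSq_fderiv_solidCyl_eq` — the same for the
  Frobenius energy density `|DV|_F²` (continuous on the compact cylinder).

HONEST FRAME: tool lemmas for the K-HOOP assembly (c); nothing here is specific to Euler or Navier–Stokes; 19832 OPEN;
NS regularity NOT proved.  [folklore (cylinder coordinates, Fubini)]
-/

noncomputable section

open MeasureTheory Set WithLp Metric Real
open scoped InnerProductSpace RealInnerProductSpace

set_option linter.dupNamespace false

namespace Summit.NavierStokesRegularity.NavierStokesRegularity.Theorems.PowerGaugeEulerLiouville.HoopCore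

open Literature.Analysis.FluidPDE Condenser

variable {V : EuclideanSpace ℝ (Fin 3) → EuclideanSpace ℝ (Fin 3)}

/-! ### The hoop density side -/

/-- The atom-subtracted hoop density of a continuous field is measurable (the frame vectors `eR`, `eTheta` are
measurable, being `cylRadius⁻¹ •` continuous fields). [folklore] -/
theorem measurable_hoopDensity (hV : Continuous V) : Measurable (hoopDensity V) := by
  have hinv : Measurable fun x : EuclideanSpace ℝ (Fin 3) => (cylRadius x)⁻¹ := continuous_cylRadius.measurable.inv
  have hR : Measurable (eR : EuclideanSpace ℝ (Fin 3) → EuclideanSpace ℝ (Fin 3)) := by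
    have h2 : Continuous fun x : EuclideanSpace ℝ (Fin 3) =>
        (toLp 2 ![x 0, x 1, 0] : EuclideanSpace ℝ (Fin 3)) := by
      fun_prop
    exact hinv.smul h2.measurable
  have hΘ : Measurable (eTheta : EuclideanSpace ℝ (Fin 3) → EuclideanSpace ℝ (Fin 3)) := by
    have h2 : Continuous fun x : EuclideanSpace ℝ (Fin 3) =>
        (toLp 2 ![-x 1, x 0, 0] : EuclideanSpace ℝ (Fin 3)) := by
      fun_prop
    exact hinv.smul h2.measurable
  have hax : Continuous fun y : EuclideanSpace ℝ (Fin 3) => V ((y 2) • eZ) :=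
    hV.comp ((PiLp.continuous_apply 2 _ 2).smul continuous_const)
  unfold hoopDensity radialVelocity swirlVelocity
  exact ((((hV.measurable.inner hR).pow_const 2).sub ((hV.measurable.inner hΘ).pow_const 2)).sub
    (((hax.measurable.inner hR).pow_const 2).sub ((hax.measurable.inner hΘ).pow_const 2))).div
    (continuous_cylRadius.measurable.pow_const 2)

/-- The coordinate box `[s₁, s₂] × ((0, T₀] × (−π, π))` has finite measure. [folklore] -/
theorem volume_box_lt_top (s₁ s₂ T₀ : ℝ) :
    volume (Icc s₁ s₂ ×ˢ (Ioc 0 T₀ ×ˢ Ioo (-π) π) : Set (ℝ × (ℝ × ℝ))) < ⊤ := by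
  have hK : IsCompact (Icc s₁ s₂ ×ˢ (Icc 0 T₀ ×ˢ Icc (-π) π) : Set (ℝ × (ℝ × ℝ))) :=
    isCompact_Icc.prod (isCompact_Icc.prod isCompact_Icc)
  exact lt_of_le_of_lt (measure_mono (prod_mono le_rfl (prod_mono Ioc_subset_Icc_self Ioo_subset_Icc_self)))
    hK.measure_lt_top

/-- **The atom-subtracted hoop density is integrable on every solid cylinder** (`V ∈ C¹`, `T₀ > 0`): by
`integrableOn_solidCyl_iff` it suffices that `t • hoopDensity V (axisPt σ t θ)` be integrable on the coordinate box,
where it is measurable and bounded (`exists_mul_abs_hoopDensity_le_solidCyl`). [folklore] -/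
theorem integrableOn_hoopDensity_solidCyl (hV : ContDiff ℝ 1 V) (s₁ s₂ : ℝ) {T₀ : ℝ} (hT₀ : 0 < T₀) :
    IntegrableOn (hoopDensity V) (solidCyl s₁ s₂ T₀) := by
  rw [integrableOn_solidCyl_iff]
  obtain ⟨C, hC⟩ := exists_mul_abs_hoopDensity_le_solidCyl hV s₁ s₂ hT₀
  have hmeas : Measurable fun p : ℝ × (ℝ × ℝ) => p.2.1 • hoopDensity V (axisPt p.1 p.2.1 p.2.2) :=
    (measurable_fst.comp measurable_snd).smul
      ((measurable_hoopDensity hV.continuous).comp continuous_axisPt.measurable)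
  refine Measure.integrableOn_of_bounded (volume_box_lt_top s₁ s₂ T₀).ne hmeas.aestronglyMeasurable (M := C) ?_
  rw [ae_restrict_iff' (measurableSet_box s₁ s₂ T₀)]
  refine ae_of_all _ fun p hp => ?_
  obtain ⟨⟨h1, h2⟩, ⟨ht, htT⟩, -⟩ := hp
  rw [norm_smul, Real.norm_eq_abs, Real.norm_eq_abs, abs_of_pos ht]
  exact hC p.1 p.2.1 p.2.2 h1 h2 ht htT

/-- **The hoop functional in cylinder coordinates** (`V ∈ C¹`, `s₁ ≤ s₂`, `T₀ > 0`):
`∫_{solidCyl s₁ s₂ T₀} hoopDensity V = ∫_{s₁}^{s₂} ∫₀^{T₀} t · (∫₀^{2π} hoopDensity V (axisPt σ t θ) dθ) dt dσ`. [folklore] -/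
theorem setIntegral_hoopDensity_solidCyl_eq (hV : ContDiff ℝ 1 V) {s₁ s₂ T₀ : ℝ} (hs : s₁ ≤ s₂) (hT₀ : 0 < T₀) :
    ∫ y in solidCyl s₁ s₂ T₀, hoopDensity V y
      = ∫ σ in s₁..s₂, ∫ t in (0 : ℝ)..T₀, t * ∫ θ in (0 : ℝ)..2 * π, hoopDensity V (axisPt σ t θ) := by
  have h := setIntegral_solidCyl_eq (hoopDensity V) (integrableOn_hoopDensity_solidCyl hV s₁ s₂ hT₀) hs hT₀.le
  simpa only [smul_eq_mul] using h

/-- The same with azimuthal averages: `∫_Z hoopDensity V = 2π ∫_{s₁}^{s₂} ∫₀^{T₀} t · circleAvg (hoopDensity V) σ t`.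
[folklore] -/
theorem setIntegral_hoopDensity_solidCyl_eq_circleAvg (hV : ContDiff ℝ 1 V) {s₁ s₂ T₀ : ℝ} (hs : s₁ ≤ s₂)
    (hT₀ : 0 < T₀) :
    ∫ y in solidCyl s₁ s₂ T₀, hoopDensity V y
      = 2 * π * ∫ σ in s₁..s₂, ∫ t in (0 : ℝ)..T₀, t * circleAvg (hoopDensity V) σ t :=
  setIntegral_solidCyl_eq_circleAvg (hoopDensity V) (integrableOn_hoopDensity_solidCyl hV s₁ s₂ hT₀) hs hT₀.le

/-! ### The Frobenius energy side -/

/-- The Frobenius energy density `y ↦ |DV(y)|_F²` of a `C¹` field is integrable on every solid cylinder (continuous on a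
compact set). [folklore] -/
theorem integrableOn_frobeniusNormSq_fderiv_solidCyl (hV : ContDiff ℝ 1 V) (s₁ s₂ T₀ : ℝ) :
    IntegrableOn (fun y => frobeniusNormSq (fderiv ℝ V y)) (solidCyl s₁ s₂ T₀) := by
  have hc : Continuous fun y => frobeniusNormSq (fderiv ℝ V y) := by
    unfold frobeniusNormSq
    exact continuous_finsetSum _ fun i _ => (((hV.continuous_fderiv one_ne_zero).clm_apply continuous_const).norm).pow 2
  exact hc.continuousOn.integrableOn_compact (isCompact_solidCyl s₁ s₂ T₀)

/-- **The Frobenius energy in cylinder coordinates** (`V ∈ C¹`, `s₁ ≤ s₂`, `0 ≤ T₀`):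
`∫_{solidCyl s₁ s₂ T₀} |DV|_F² = ∫_{s₁}^{s₂} ∫₀^{T₀} t · (∫₀^{2π} |DV(axisPt σ t θ)|_F² dθ) dt dσ`. [folklore] -/
theorem setIntegral_frobeniusNormSq_fderiv_solidCyl_eq (hV : ContDiff ℝ 1 V) {s₁ s₂ T₀ : ℝ} (hs : s₁ ≤ s₂)
    (hT₀ : 0 ≤ T₀) :
    ∫ y in solidCyl s₁ s₂ T₀, frobeniusNormSq (fderiv ℝ V y)
      = ∫ σ in s₁..s₂, ∫ t in (0 : ℝ)..T₀,
          t * ∫ θ in (0 : ℝ)..2 * π, frobeniusNormSq (fderiv ℝ V (axisPt σ t θ)) := by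
  have h := setIntegral_solidCyl_eq (fun y => frobeniusNormSq (fderiv ℝ V y))
    (integrableOn_frobeniusNormSq_fderiv_solidCyl hV s₁ s₂ T₀) hs hT₀
  simpa only [smul_eq_mul] using h

/-- The same with azimuthal averages: `∫_Z |DV|_F² = 2π ∫_{s₁}^{s₂} ∫₀^{T₀} t · circleAvg (|DV|_F²) σ t`. [folklore] -/
theorem setIntegral_frobeniusNormSq_fderiv_solidCyl_eq_circleAvg (hV : ContDiff ℝ 1 V) {s₁ s₂ T₀ : ℝ}
    (hs : s₁ ≤ s₂) (hT₀ : 0 ≤ T₀) :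
    ∫ y in solidCyl s₁ s₂ T₀, frobeniusNormSq (fderiv ℝ V y)
      = 2 * π * ∫ σ in s₁..s₂, ∫ t in (0 : ℝ)..T₀,
          t * circleAvg (fun y => frobeniusNormSq (fderiv ℝ V y)) σ t :=
  setIntegral_solidCyl_eq_circleAvg _ (integrableOn_frobeniusNormSq_fderiv_solidCyl hV s₁ s₂ T₀) hs hT₀

end Summit.NavierStokesRegularity.NavierStokesRegularity.Theorems.PowerGaugeEulerLiouville.HoopCore

end
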